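import Literature.Analysis.FluidPDE.NormalisedPressureFarField
import HarnessLib

/-!
# The quadrupole far-field limit of the pressure along an axis (Ożański 2017, (3.5))

Analysis/FluidPDE support file (serves the formalisation of Scheffer's construction of singular
weak solutions of the Navier–Stokes inequality in the presentation of W. S. Ożański,
arXiv:1709.00602, §3.2, eq. (3.5): for `u ∈ C_0^∞(ℝ³)` the pressure function
`p = Σᵢⱼ ∂ᵢ∂ⱼΨ ∗ (uᵢuⱼ)` satisfies
`lim_{x₁→±∞} x₁⁴ ∂₁p(x₁,0,0) = ±(3/4π) ∫ (|u(y)|² - 3u₁(y)²) dy`,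
the input of Lemma 7 (i) there — the pressure interaction function has a definite far-field
sign — and hence of the whole geometric arrangement of §5).

For the tree's normalised pressure `p̃[v] = normalisedPressure v` of a field `v ∈ C²_c(ℝ³; ℝ³)`
and a unit vector `e` we prove the coordinate-free form

  `s⁴ ∂ₑp̃[v](s e) ⟶ (3/4π) ∫ (|v(y)|² - 3⟨e, v(y)⟩²) dy`  as `s → +∞`
  (`tendsto_pow_four_mul_fderiv_normalisedPressure_atTop`),

from the far-field formula `∂ₑp̃[v](x) = -∫ D³Γ(x-y)(e, v y, v y) dy`
(`fderiv_normalisedPressure_apply_of_lt_norm`, `NormalisedPressureFarField`), the homogeneity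
`s⁴ D³Γ(s e - y) = D³Γ(e - y/s) → D³Γ(e)` (dominated convergence), and **Euler's relation**
for the degree-`(-3)` homogeneous Hessian, `D³Γ(e)(e) = -3 D²Γ(e)`, whence
`D³Γ(e)(e, a, a) = 3K(e)(a) = 3(3⟨e,a⟩² - |a|²)/(4π)` — no third-derivative calculus is needed.

## Contents (all proved)

* `fderiv_apply_self_of_homogeneous` — Euler's relation `DΦ(z) z = m Φ(z)` for `Φ` homogeneous
  of degree `m ∈ ℤ` and differentiable at `z`;
* `fderiv3_newtonKernel_apply_self`, `fderiv3_newtonKernel_apply_self_apply_apply` —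
  `D³Γ(z)(z) = -3 D²Γ(z)`, `D³Γ(z)(z, a, a) = 3 K(z)(a)` (`z ≠ 0`);
* `tendsto_pow_four_mul_fderiv_normalisedPressure_atTop` / `…_atBot` — Ożański's (3.5) for
  `x₁ → +∞` and `x₁ → -∞` (limits `±(3/4π)∫(|v|² - 3⟨e,v⟩²)`).

## Mathlib search

`hasDerivAt_zpow`, `HasFDerivAt.comp_hasDerivAt`, `HasDerivAt.smul_const`, `HasDerivAt.unique`,
`tendsto_integral_filter_of_dominated_convergence`, `tendsto_inv_atTop_zero`,
`Filter.Tendsto.smul_const` (used).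

## References

* W. S. Ożański, *On weak solutions to the Navier–Stokes inequality with internal
  singularities*, arXiv:1709.00602 (2017), §3.2 (3.5); Lemma 7 (i). [`Ozanski2017NSISingular`]
* V. Scheffer, *A solution to the Navier–Stokes inequality with an internal singularity*,
  Comm. Math. Phys. 101 (1985), §3. [`Scheffer1985`]
-/

noncomputable section

open MeasureTheory Set Filter Metric Topology Function Real InnerProductSpace
open scoped RealInnerProductSpace ContDiff ENNReal

namespace Literature.Analysis.FluidPDE

/-! ### Euler's relation for homogeneous functions -/

section Euler

variable {E : Type*} [NormedAddCommGroup E] [NormedSpace ℝ E]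
variable {F : Type*} [NormedAddCommGroup F] [NormedSpace ℝ F]

/-- **Euler's relation for homogeneous functions**: if `Φ(c z) = c^m Φ(z)` for all `c > 0` and
all `z`, and `Φ` is differentiable at `z`, then `DΦ(z) z = m Φ(z)` (differentiate
`c ↦ Φ(c z) = c^m Φ(z)` at `c = 1`). [folklore] -/
theorem fderiv_apply_self_of_homogeneous (Φ : E → F) (m : ℤ)
    (hΦ : ∀ c : ℝ, 0 < c → ∀ z, Φ (c • z) = c ^ m • Φ z) {z : E}
    (hd : DifferentiableAt ℝ Φ z) : fderiv ℝ Φ z z = (m : ℝ) • Φ z := by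
  -- the line `c ↦ c • z` and the chain rule at `c = 1`
  have hline : HasDerivAt (fun c : ℝ => c • z) z 1 := by
    simpa using (hasDerivAt_id (1 : ℝ)).smul_const z
  have hd1 : DifferentiableAt ℝ Φ ((1 : ℝ) • z) := by rwa [one_smul]
  have h1 : HasDerivAt (fun c : ℝ => Φ (c • z)) (fderiv ℝ Φ z z) 1 := by
    have := hd1.hasFDerivAt.comp_hasDerivAt (1 : ℝ) hline
    rwa [one_smul] at this
  -- the power law near `c = 1`
  have h2 : HasDerivAt (fun c : ℝ => c ^ m • Φ z) (((m : ℝ) * (1 : ℝ) ^ (m - 1)) • Φ z) 1 :=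
    (hasDerivAt_zpow m 1 (Or.inl one_ne_zero)).smul_const (Φ z)
  have heq : (fun c : ℝ => Φ (c • z)) =ᶠ[𝓝 1] fun c => c ^ m • Φ z := by
    filter_upwards [Ioi_mem_nhds one_pos] with c hc
    exact hΦ c hc z
  have h2' : HasDerivAt (fun c : ℝ => Φ (c • z)) (((m : ℝ) * (1 : ℝ) ^ (m - 1)) • Φ z) 1 :=
    h2.congr_of_eventuallyEq heq
  have := h1.unique h2'
  rw [this, one_zpow, mul_one]

end Euler

/-! ### The third derivative of the Newtonian kernel along the radial direction -/

section Newton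

-- nested operator types `ℝ³ →L[ℝ] ℝ³ →L[ℝ] ℝ³ →L[ℝ] ℝ`
set_option maxSynthPendingDepth 3

/-- **`D³Γ(z)(z) = -3 D²Γ(z)`** for `z ≠ 0` (Euler's relation for the Hessian `D²Γ`, which is
homogeneous of degree `-3`). [folklore] -/
theorem fderiv3_newtonKernel_apply_self {z : EuclideanSpace ℝ (Fin 3)} (hz : z ≠ 0) :
    fderiv ℝ (fderiv ℝ (fderiv ℝ newtonKernel)) z z =
      (-3 : ℝ) • fderiv ℝ (fderiv ℝ newtonKernel) z := by
  have hd : DifferentiableAt ℝ (fderiv ℝ (fderiv ℝ newtonKernel)) z :=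
    (contDiffOn_fderiv2_newtonKernel (n := 1)).differentiableOn one_ne_zero z hz
      |>.differentiableAt (isOpen_compl_singleton.mem_nhds hz)
  have h := fderiv_apply_self_of_homogeneous (fderiv ℝ (fderiv ℝ newtonKernel)) (-3)
    fderiv2_newtonKernel_homogeneous hd
  rw [h]
  norm_num

/-- **`D³Γ(z)(z, a, a) = 3 K(z)(a)`** for `z ≠ 0`, `K` the pressure kernel
(`K(z)(a) = -D²Γ(z)(a,a) = (3⟨z,a⟩² - |a|²|z|²)/(4π|z|⁵)`). [folklore] -/
theorem fderiv3_newtonKernel_apply_self_apply_apply {z : EuclideanSpace ℝ (Fin 3)} (hz : z ≠ 0)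
    (a : EuclideanSpace ℝ (Fin 3)) :
    fderiv ℝ (fderiv ℝ (fderiv ℝ newtonKernel)) z z a a = 3 * pressureKernel z a := by
  rw [fderiv3_newtonKernel_apply_self hz, pressureKernel_eq_neg_fderiv2 hz a]
  simp only [_root_.FunLike.coe_smul, Pi.smul_apply, smul_eq_mul]
  ring

/-- The pressure kernel at a unit vector: `K(e)(a) = (3⟨e,a⟩² - |a|²)/(4π)` for `|e| = 1`. [folklore] -/
theorem pressureKernel_of_norm_eq_one {e : EuclideanSpace ℝ (Fin 3)} (he : ‖e‖ = 1)
    (a : EuclideanSpace ℝ (Fin 3)) :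
    pressureKernel e a = (3 * ⟪e, a⟫ ^ 2 - ‖a‖ ^ 2) / (4 * π) := by
  rw [pressureKernel_eq_fin3, he]
  ring

end Newton

/-! ### The far-field limit along an axis -/

section Limit

-- nested operator types `ℝ³ →L[ℝ] ℝ³ →L[ℝ] ℝ³ →L[ℝ] ℝ`
set_option maxSynthPendingDepth 3

variable {v : EuclideanSpace ℝ (Fin 3) → EuclideanSpace ℝ (Fin 3)}

/-- For a compactly supported field there is a radius `R ≥ 0` with `supp v ⊆ B̄(0, R)`. [folklore] -/
theorem exists_tsupport_subset_closedBall (hc : HasCompactSupport v) :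
    ∃ R : ℝ, 0 ≤ R ∧ tsupport v ⊆ closedBall (0 : EuclideanSpace ℝ (Fin 3)) R := by
  obtain ⟨R, hR⟩ := hc.isCompact.isBounded.subset_closedBall (0 : EuclideanSpace ℝ (Fin 3))
  refine ⟨max R 0, le_max_right _ _, hR.trans (closedBall_subset_closedBall (le_max_left _ _))⟩

/-- Rescaling the far-field integrand: `s⁴ D³Γ(s e - y) = D³Γ(e - s⁻¹ y)` for `s > 0`
(homogeneity of degree `-4`). [folklore] -/
theorem pow_four_smul_fderiv3_newtonKernel_sub {s : ℝ} (hs : 0 < s)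
    (e y : EuclideanSpace ℝ (Fin 3)) :
    s ^ 4 • fderiv ℝ (fderiv ℝ (fderiv ℝ newtonKernel)) (s • e - y) =
      fderiv ℝ (fderiv ℝ (fderiv ℝ newtonKernel)) (e - s⁻¹ • y) := by
  have h : s • e - y = s • (e - s⁻¹ • y) := by
    rw [smul_sub, smul_smul, mul_inv_cancel₀ hs.ne', one_smul]
  rw [h, fderiv3_newtonKernel_homogeneous s hs, smul_smul,
    show s ^ 4 * s ^ (-4 : ℤ) = 1 by
      rw [zpow_neg, show ((4 : ℤ) : ℤ) = ((4 : ℕ) : ℤ) from rfl, zpow_natCast,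
        mul_inv_cancel₀ (pow_ne_zero _ hs.ne')],
    one_smul]

/-- Continuity of the evaluation `(L, a) ↦ L e a a` on third-derivative-valued data. [folklore] -/
theorem continuous_eval3 (e : EuclideanSpace ℝ (Fin 3)) :
    Continuous fun q : ((EuclideanSpace ℝ (Fin 3)) →L[ℝ] (EuclideanSpace ℝ (Fin 3)) →L[ℝ]
      (EuclideanSpace ℝ (Fin 3)) →L[ℝ] ℝ) × EuclideanSpace ℝ (Fin 3) => q.1 e q.2 q.2 := by
  have h1 : Continuous fun q : ((EuclideanSpace ℝ (Fin 3)) →L[ℝ] (EuclideanSpace ℝ (Fin 3)) →L[ℝ]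
      (EuclideanSpace ℝ (Fin 3)) →L[ℝ] ℝ) × EuclideanSpace ℝ (Fin 3) => q.1 e :=
    (ContinuousLinearMap.apply ℝ _ e).continuous.comp continuous_fst
  exact (isBoundedBilinearMap_apply.continuous.comp (h1.prodMk continuous_snd)).clm_apply
    continuous_snd

/-- Norm bound for the evaluation: `|L e a a| ≤ ‖L‖ |e| |a|²`. [folklore] -/
theorem norm_eval3_le (L : (EuclideanSpace ℝ (Fin 3)) →L[ℝ] (EuclideanSpace ℝ (Fin 3)) →L[ℝ]
      (EuclideanSpace ℝ (Fin 3)) →L[ℝ] ℝ) (e a : EuclideanSpace ℝ (Fin 3)) :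
    ‖L e a a‖ ≤ ‖L‖ * ‖e‖ * ‖a‖ ^ 2 := by
  calc ‖L e a a‖ ≤ ‖L e a‖ * ‖a‖ := ContinuousLinearMap.le_opNorm _ _
    _ ≤ ‖L e‖ * ‖a‖ * ‖a‖ :=
        mul_le_mul_of_nonneg_right (ContinuousLinearMap.le_opNorm _ _) (norm_nonneg _)
    _ ≤ ‖L‖ * ‖e‖ * ‖a‖ * ‖a‖ :=
        mul_le_mul_of_nonneg_right (mul_le_mul_of_nonneg_right (ContinuousLinearMap.le_opNorm _ _)
          (norm_nonneg _)) (norm_nonneg _)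
    _ = ‖L‖ * ‖e‖ * ‖a‖ ^ 2 := by ring

/-- **Uniform bound for the rescaled far-field integrand**: if `‖D³Γ(z)‖ ≤ M/|z|⁴` off the
origin, `|e| = 1`, `|y| ≤ R` and `s ≥ 2R`, `s > 0`, then
`|D³Γ(e - s⁻¹y)(e, a, a)| ≤ 16 M |a|²` (`|e - s⁻¹y| ≥ 1/2`). [folklore] -/
theorem norm_fderiv3_newtonKernel_rescaled_apply_le {M : ℝ}
    (hM : ∀ z : EuclideanSpace ℝ (Fin 3), z ≠ 0 →
      ‖fderiv ℝ (fderiv ℝ (fderiv ℝ newtonKernel)) z‖ ≤ M / ‖z‖ ^ 4)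
    {e y : EuclideanSpace ℝ (Fin 3)} (he : ‖e‖ = 1) {R s : ℝ} (hy : ‖y‖ ≤ R) (hs : 2 * R ≤ s)
    (hs0 : 0 < s) (a : EuclideanSpace ℝ (Fin 3)) :
    ‖fderiv ℝ (fderiv ℝ (fderiv ℝ newtonKernel)) (e - s⁻¹ • y) e a a‖ ≤ 16 * M * ‖a‖ ^ 2 := by
  have hM0 : 0 ≤ M := by
    have h := hM e (by intro h0; rw [h0, norm_zero] at he; exact zero_ne_one he)
    rw [he, one_pow, div_one] at h
    exact (norm_nonneg _).trans h
  have hsy : ‖s⁻¹ • y‖ ≤ 1 / 2 := by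
    rw [norm_smul, norm_inv, Real.norm_eq_abs, abs_of_pos hs0, inv_mul_le_iff₀ hs0]
    linarith
  have hw : 1 / 2 ≤ ‖e - s⁻¹ • y‖ := by
    have := norm_sub_norm_le e (s⁻¹ • y)
    rw [he] at this
    linarith
  have hw0 : e - s⁻¹ • y ≠ 0 := by
    intro h; rw [h, norm_zero] at hw; linarith
  have hpow : (1 / 2 : ℝ) ^ 4 ≤ ‖e - s⁻¹ • y‖ ^ 4 := pow_le_pow_left₀ (by norm_num) hw 4
  have hD3w : ‖fderiv ℝ (fderiv ℝ (fderiv ℝ newtonKernel)) (e - s⁻¹ • y)‖ ≤ 16 * M := by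
    refine (hM _ hw0).trans ?_
    rw [div_le_iff₀ (lt_of_lt_of_le (by norm_num) hpow)]
    calc M = 16 * M * (1 / 2 : ℝ) ^ 4 := by ring
      _ ≤ 16 * M * ‖e - s⁻¹ • y‖ ^ 4 :=
          mul_le_mul_of_nonneg_left hpow (by positivity)
  calc ‖fderiv ℝ (fderiv ℝ (fderiv ℝ newtonKernel)) (e - s⁻¹ • y) e a a‖
      ≤ ‖fderiv ℝ (fderiv ℝ (fderiv ℝ newtonKernel)) (e - s⁻¹ • y)‖ * ‖e‖ * ‖a‖ ^ 2 :=
        norm_eval3_le _ _ _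
    _ ≤ 16 * M * ‖e‖ * ‖a‖ ^ 2 :=
        mul_le_mul_of_nonneg_right (mul_le_mul_of_nonneg_right hD3w (norm_nonneg _))
          (sq_nonneg _)
    _ = 16 * M * ‖a‖ ^ 2 := by rw [he, mul_one]

/-- **Pointwise limit of the rescaled far-field integrand**: `D³Γ(e - s⁻¹y)(e, a, a) → D³Γ(e)(e, a, a)`
as `s → +∞` (`e ≠ 0`; `D³Γ` is continuous off the origin). [folklore] -/
theorem tendsto_fderiv3_newtonKernel_rescaled_apply {e : EuclideanSpace ℝ (Fin 3)} (he0 : e ≠ 0)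
    (y a : EuclideanSpace ℝ (Fin 3)) :
    Tendsto (fun s : ℝ => fderiv ℝ (fderiv ℝ (fderiv ℝ newtonKernel)) (e - s⁻¹ • y) e a a) atTop
      (𝓝 (fderiv ℝ (fderiv ℝ (fderiv ℝ newtonKernel)) e e a a)) := by
  have h1 : Tendsto (fun s : ℝ => e - s⁻¹ • y) atTop (𝓝 (e - (0 : ℝ) • y)) :=
    tendsto_const_nhds.sub (tendsto_inv_atTop_zero.smul_const y)
  rw [zero_smul, sub_zero] at h1
  have h2 : ContinuousAt (fderiv ℝ (fderiv ℝ (fderiv ℝ newtonKernel))) e :=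
    (contDiffOn_fderiv3_newtonKernel (n := 0)).continuousOn.continuousAt
      (isOpen_compl_singleton.mem_nhds he0)
  have h3 := h2.tendsto.comp h1
  have h4 : Tendsto (fun s : ℝ => (fderiv ℝ (fderiv ℝ (fderiv ℝ newtonKernel)) (e - s⁻¹ • y), a))
      atTop (𝓝 (fderiv ℝ (fderiv ℝ (fderiv ℝ newtonKernel)) e, a)) :=
    h3.prodMk_nhds tendsto_const_nhds
  exact ((continuous_eval3 e).tendsto _).comp h4

/-- Measurability of the rescaled far-field integrand in `y`. [folklore] -/
theorem aestronglyMeasurable_fderiv3_newtonKernel_rescaled_apply (hv : Continuous v)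
    (e : EuclideanSpace ℝ (Fin 3)) (s : ℝ) :
    AEStronglyMeasurable
      (fun y => fderiv ℝ (fderiv ℝ (fderiv ℝ newtonKernel)) (e - s⁻¹ • y) e (v y) (v y))
      (volume : Measure (EuclideanSpace ℝ (Fin 3))) := by
  have hD3m : Measurable (fderiv ℝ (fderiv ℝ (fderiv ℝ newtonKernel))) := measurable_fderiv ℝ _
  have hin : Measurable fun y : EuclideanSpace ℝ (Fin 3) =>
      (fderiv ℝ (fderiv ℝ (fderiv ℝ newtonKernel)) (e - s⁻¹ • y), v y) :=
    (hD3m.comp (measurable_const.sub (measurable_const_smul _))).prodMk hv.measurable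
  exact ((continuous_eval3 e).measurable.comp hin).aestronglyMeasurable

/-- **Dominated convergence for the rescaled far-field integrals**: for `v` continuous and
supported in `B̄(0,R)` and `|e| = 1`,
`∫ D³Γ(e - s⁻¹y)(e, v y, v y) dy → ∫ D³Γ(e)(e, v y, v y) dy` as `s → +∞`. [folklore] -/
theorem tendsto_integral_fderiv3_newtonKernel_rescaled (hv : Continuous v) {R : ℝ}
    (hsupp : tsupport v ⊆ closedBall (0 : EuclideanSpace ℝ (Fin 3)) R)
    {e : EuclideanSpace ℝ (Fin 3)} (he : ‖e‖ = 1) :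
    Tendsto (fun s : ℝ => ∫ y, fderiv ℝ (fderiv ℝ (fderiv ℝ newtonKernel)) (e - s⁻¹ • y) e (v y) (v y))
      atTop (𝓝 (∫ y, fderiv ℝ (fderiv ℝ (fderiv ℝ newtonKernel)) e e (v y) (v y))) := by
  have he0 : e ≠ 0 := by
    intro h; rw [h, norm_zero] at he; exact zero_ne_one he
  have hL2 := integrable_norm_sq_of_tsupport_subset hv hsupp
  obtain ⟨M, -, hM⟩ := exists_norm_fderiv3_newtonKernel_le
  refine tendsto_integral_filter_of_dominated_convergence (fun y => 16 * M * ‖v y‖ ^ 2)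
    (Eventually.of_forall fun s => aestronglyMeasurable_fderiv3_newtonKernel_rescaled_apply hv e s)
    ?_ (hL2.const_mul _) (Eventually.of_forall fun y =>
      tendsto_fderiv3_newtonKernel_rescaled_apply he0 y (v y))
  filter_upwards [eventually_ge_atTop (2 * R), eventually_gt_atTop 0] with s hs hs0
  refine Eventually.of_forall fun y => ?_
  by_cases hy : y ∈ tsupport v
  · exact norm_fderiv3_newtonKernel_rescaled_apply_le hM he (mem_closedBall_zero_iff.1 (hsupp hy))
      hs hs0 (v y)
  · have h0 : v y = 0 := image_eq_zero_of_notMem_tsupport hy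
    simp only [h0, map_zero, norm_zero]
    norm_num

/-- **The value of the limiting integral**: `∫ D³Γ(e)(e, v y, v y) dy
= -(3/4π) ∫ (|v|² - 3⟨e,v⟩²)` for `|e| = 1` (Euler's relation, `D³Γ(e)(e,a,a) = 3K(e)(a)`). [folklore] -/
theorem integral_fderiv3_newtonKernel_self_apply (v : EuclideanSpace ℝ (Fin 3) → EuclideanSpace ℝ (Fin 3))
    {e : EuclideanSpace ℝ (Fin 3)} (he : ‖e‖ = 1) :
    ∫ y, fderiv ℝ (fderiv ℝ (fderiv ℝ newtonKernel)) e e (v y) (v y) =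
      -(3 / (4 * π)) * ∫ y, (‖v y‖ ^ 2 - 3 * ⟪e, v y⟫ ^ 2) := by
  have he0 : e ≠ 0 := by
    intro h; rw [h, norm_zero] at he; exact zero_ne_one he
  rw [← integral_const_mul]
  refine integral_congr_ae (Eventually.of_forall fun y => ?_)
  simp only
  rw [fderiv3_newtonKernel_apply_self_apply_apply he0, pressureKernel_of_norm_eq_one he]
  ring

/-- **The quadrupole far-field limit of the pressure along an axis (Ożański 2017, (3.5)).** For
`v ∈ C²_c(ℝ³; ℝ³)` and a unit vector `e`,
`s⁴ ∂ₑp̃[v](s e) → (3/4π) ∫ (|v(y)|² - 3⟨e, v(y)⟩²) dy` as `s → +∞`; with `e = e₁` this is the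
printed `lim_{x₁→∞} x₁⁴ ∂₁p(x₁,0,0) = (3/4π)∫(|u|² - 3u₁²) dy`. (Far-field formula for `∂ₑp̃`,
homogeneity `s⁴D³Γ(se - y) = D³Γ(e - y/s) → D³Γ(e)` by dominated convergence, and Euler's
relation `D³Γ(e)(e,a,a) = 3K(e)(a)`.) [cite: Ozanski2017NSISingular, §3.2 (3.5)] -/
theorem tendsto_pow_four_mul_fderiv_normalisedPressure_atTop (hv : ContDiff ℝ 2 v)
    (hc : HasCompactSupport v) {e : EuclideanSpace ℝ (Fin 3)} (he : ‖e‖ = 1) :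
    Tendsto (fun s : ℝ => s ^ 4 * fderiv ℝ (normalisedPressure v) (s • e) e) atTop
      (𝓝 ((3 / (4 * π)) * ∫ y, (‖v y‖ ^ 2 - 3 * ⟪e, v y⟫ ^ 2))) := by
  obtain ⟨R, -, hsupp⟩ := exists_tsupport_subset_closedBall hc
  -- Step 1: eventually, `s⁴ ∂ₑp̃(se) = -∫ D³Γ(e - s⁻¹y)(e, v y, v y) dy`
  have hev : ∀ᶠ s in atTop, -∫ y, fderiv ℝ (fderiv ℝ (fderiv ℝ newtonKernel)) (e - s⁻¹ • y) e (v y) (v y)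
      = s ^ 4 * fderiv ℝ (normalisedPressure v) (s • e) e := by
    filter_upwards [eventually_gt_atTop (R + 2), eventually_gt_atTop 0] with s hs hs0
    have hnorm : R + 2 < ‖s • e‖ := by
      rw [norm_smul, Real.norm_eq_abs, abs_of_pos hs0, he, mul_one]; exact hs
    rw [fderiv_normalisedPressure_apply_of_lt_norm hv hsupp hnorm e, mul_neg, ← integral_const_mul,
      neg_inj]
    refine integral_congr_ae (Eventually.of_forall fun y => ?_)
    have key := congrArg (fun L : (EuclideanSpace ℝ (Fin 3)) →L[ℝ] (EuclideanSpace ℝ (Fin 3)) →L[ℝ]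
        (EuclideanSpace ℝ (Fin 3)) →L[ℝ] ℝ => L e (v y) (v y))
      (pow_four_smul_fderiv3_newtonKernel_sub hs0 e y)
    simp only [_root_.FunLike.coe_smul, Pi.smul_apply, smul_eq_mul] at key
    exact key.symm
  -- Step 2: dominated convergence and the value of the limit
  have hDCT := (tendsto_integral_fderiv3_newtonKernel_rescaled hv.continuous hsupp he).neg
  rw [integral_fderiv3_newtonKernel_self_apply v he, neg_mul, neg_neg] at hDCT
  exact hDCT.congr' hev

/-- **The far-field limit in the negative direction (Ożański 2017, (3.5), `x₁ → -∞`)**: for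
`v ∈ C²_c(ℝ³; ℝ³)` and a unit vector `e`,
`s⁴ ∂ₑp̃[v](s e) → -(3/4π) ∫ (|v(y)|² - 3⟨e, v(y)⟩²) dy` as `s → -∞` (apply the `+∞` statement
to `-e` and use `∂₋ₑ = -∂ₑ`). [cite: Ozanski2017NSISingular, §3.2 (3.5)] -/
theorem tendsto_pow_four_mul_fderiv_normalisedPressure_atBot (hv : ContDiff ℝ 2 v)
    (hc : HasCompactSupport v) {e : EuclideanSpace ℝ (Fin 3)} (he : ‖e‖ = 1) :
    Tendsto (fun s : ℝ => s ^ 4 * fderiv ℝ (normalisedPressure v) (s • e) e) atBot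
      (𝓝 (-(3 / (4 * π)) * ∫ y, (‖v y‖ ^ 2 - 3 * ⟪e, v y⟫ ^ 2))) := by
  have hne : ‖-e‖ = 1 := by rw [norm_neg, he]
  have h := ((tendsto_pow_four_mul_fderiv_normalisedPressure_atTop hv hc hne).comp
    tendsto_neg_atBot_atTop).neg
  have hval : -((3 / (4 * π)) * ∫ y, (‖v y‖ ^ 2 - 3 * ⟪-e, v y⟫ ^ 2)) =
      -(3 / (4 * π)) * ∫ y, (‖v y‖ ^ 2 - 3 * ⟪e, v y⟫ ^ 2) := by
    simp only [inner_neg_left, neg_sq]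
    ring
  rw [hval] at h
  refine h.congr fun s => ?_
  simp only [comp_apply, neg_smul, smul_neg, neg_neg, map_neg]
  ring

end Limit

end Literature.Analysis.FluidPDE

end
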